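import Summits.HodgeConjecture.HodgeCM.PerL34.GenuineSchrodingerShift_1

/-! PORT of `HodgeCM/PerL34/GenuineSchrodingerShift.lean` (HodgeCMPerL run 82) — part 2: continuation of `Summits.HodgeConjecture.HodgeCM.PerL34.GenuineSchrodingerShift_1` (split at a top-level declaration boundary by port_pkg.py; scope re-opened below; declarations unchanged). -/

-- port_pkg: scope re-opened for this part (file-level context, then the namespace/section stack open at the cut)
set_option linter.style.longFile 0
set_option linter.unusedSectionVars false
set_option linter.unusedVariables false
noncomputable section
open MeasureTheory MeasureTheory.Measure Set Metric Function Complex ComplexConjugate Topology Filter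
open scoped RestrictedProduct InnerProductSpace NNReal ENNReal Pointwise
namespace HodgeCM.PerL34.PureTensor
open HodgeCM.PerL34.LocalFactors HodgeCM.PerL34.LocalFactors.DilationModel
open HodgeCM.PerL34.IdelePlaces HodgeCM.PerL34.RestrictedRegroup HodgeCM.PerL34.RestrictedCutout
open HodgeCM.PerL34.IdelicTorusModel HodgeCM.PerL34.IdelicTorusModel.Genuine NumberField IsDedekindDomain
open HodgeCM.PerL34.NoSmallSubgroups
attribute [local instance] LocalFactors.DilationModel.Adic.nontriviallyNormedField
  LocalFactors.DilationModel.Adic.properSpace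
namespace SchrodingerModel
variable {L : Type} [Field L] [NumberField L] [IsCMField L]
local notation3 "L⁺" => maximalRealSubfield L
local notation3 "𝕂" i => (basePlaceOf L (Subtype.val i)).adicCompletion (maximalRealSubfield L)
namespace Coeff
section Main
variable [∀ v : HeightOneSpectrum (𝓞 (maximalRealSubfield L)), MeasurableSpace (v.adicCompletion (maximalRealSubfield L))]
  [∀ v : HeightOneSpectrum (𝓞 (maximalRealSubfield L)), BorelSpace (v.adicCompletion (maximalRealSubfield L))]
  [DecidableEq (Place (maximalRealSubfield L))]
/-- **`hM` for the shifted vector** (every finite `S`, every `ν`, every finitely supported shift `e`): the diagonal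
coefficient of `φ_e` FACTORISES as the product of the local coefficients -/
theorem inner_phiE_rep_extendOne (e : Space L) (Se : Finset (SplitIdx L)) (heS : ∀ j : SplitIdx L, j ∉ Se → e j = 0)
    (ν : Model L →* Circle) (S : Finset (Place L⁺)) (y : (i : ↥S) → locTorus L⁺ L i) :
    inner ℂ (phiE e) (rep L ν (extendOne (genLevel L) S y) (phiE e)) =
      ∏ i : ↥S, localCoeff (genLevel L) (rep L ν) (phiE e) i (y i) :=
  apply_extendOne_of_mulDisjoint (genLevel L) (fun k => inner ℂ (phiE e) (rep L ν k (phiE e)))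
    (inner_map_one_of_norm_eq_one (genLevel L) (rep L ν) (norm_phiE e)) (inner_phiE_rep_mul_of_disjoint e Se heS ν) S y

/-! ## §4  Shifts attached to a finite set of places -/

/-- the shift vector with coordinates `(c_v, c_v, c_v)` at the split `v ∈ S` and `0` elsewhere -/
def shiftVec (S : Finset (Place L⁺)) (c : ∀ i : Place L⁺, (basePlaceOf L i).adicCompletion L⁺) : Space L :=
  ⟨fun j => if j.1 ∈ S then (fun _ : Fin 3 => c j.1) else (0 : Coord L j), by
    refine Filter.eventually_cofinite.2 ((S.finite_toSet.preimage Subtype.val_injective.injOn).subset ?_)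
    intro j hj
    by_contra hjS
    have hjS' : j.1 ∉ S := fun h => hjS (Set.mem_preimage.2 (Finset.mem_coe.2 h))
    exact hj (by
      show (if j.1 ∈ S then (fun _ : Fin 3 => c j.1) else (0 : Coord L j)) ∈ cube L j
      rw [if_neg hjS']
      exact zero_mem (cube L j))⟩

/-- (Ported verbatim from the HodgeCMPerL package; no docstring in the source.) -/
theorem shiftVec_apply (S : Finset (Place L⁺)) (c : ∀ i : Place L⁺, (basePlaceOf L i).adicCompletion L⁺)
    (j : SplitIdx L) : shiftVec S c j = if j.1 ∈ S then (fun _ : Fin 3 => c j.1) else (0 : Coord L j) := rfl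

/-- (Ported verbatim from the HodgeCMPerL package; no docstring in the source.) -/
theorem shiftVec_apply_of_mem {S : Finset (Place L⁺)} (c : ∀ i : Place L⁺, (basePlaceOf L i).adicCompletion L⁺)
    {j : SplitIdx L} (hj : j.1 ∈ S) : shiftVec S c j = fun _ : Fin 3 => c j.1 := by
  rw [shiftVec_apply, if_pos hj]

/-- (Ported verbatim from the HodgeCMPerL package; no docstring in the source.) -/
theorem shiftVec_apply_of_not_mem {S : Finset (Place L⁺)} (c : ∀ i : Place L⁺, (basePlaceOf L i).adicCompletion L⁺)
    {j : SplitIdx L} (hj : j.1 ∉ S) : shiftVec S c j = 0 := by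
  rw [shiftVec_apply, if_neg hj]

/-- the shift vector vanishes off a finite set of split indices -/
theorem exists_finset_shiftVec_eq_zero (S : Finset (Place L⁺))
    (c : ∀ i : Place L⁺, (basePlaceOf L i).adicCompletion L⁺) :
    ∃ Se : Finset (SplitIdx L), ∀ j : SplitIdx L, j ∉ Se → shiftVec S c j = 0 :=
  ⟨(S.finite_toSet.preimage Subtype.val_injective.injOn).toFinset, fun j hj =>
    shiftVec_apply_of_not_mem c fun h => hj ((Set.Finite.mem_toFinset _).2 h)⟩

/-! ## §5  The choice of the centres: `χ(ι_v g) = 1` on `U1 (t,t,t) 1 = 1 + t⁻¹𝒪_v` for `‖t‖` large -/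

/-- **centre at a split place for a character with a level**: there is `t ∈ L⁺_v` with `‖t‖ > 1` such that
`χ(ι_v g) = 1` whenever `baseTriv g ∈ U1 (t,t,t) 1` (pv13-g4's character radius `exists_radius_forall_U1_char_eq_one`
at the centre `(1,1,1)`, rescaled by `t` with `‖t‖ > r₀⁻¹`). -/
theorem exists_centre (χ : Model L →* Circle) {T' : Finset (Place L⁺)}
    (hχT' : RestrictedProduct.boxSubgroup (genLevel L) T' ≤ χ.ker)
    (hlocχ : ∀ i ∈ T', Continuous fun g : locTorus L⁺ L i => χ (RestrictedProduct.mulSingle (genLevel L) i g))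
    (i : Place L⁺) (hs : IsSplitPlace L i) :
    ∃ t : (basePlaceOf L i).adicCompletion L⁺, 1 < ‖t‖ ∧ ∀ g : locTorus L⁺ L i,
      ((baseTriv L i hs g : ((basePlaceOf L i).adicCompletion L⁺)ˣ) : (basePlaceOf L i).adicCompletion L⁺) ∈
          U1 (fun _ : Fin 3 => t) 1 →
        χ (RestrictedProduct.mulSingle (genLevel L) i g) = 1 := by
  obtain ⟨r₀, hr₀, hr₀1, h⟩ := exists_radius_forall_U1_char_eq_one hχT' hlocχ i hs
    (x₀ := fun _ : Fin 3 => (1 : (basePlaceOf L i).adicCompletion L⁺)) (fun h => one_ne_zero (congr_fun h 0))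
  rw [pi_norm_const, norm_one] at hr₀1
  obtain ⟨t, ht⟩ := NormedField.exists_lt_norm ((basePlaceOf L i).adicCompletion L⁺) r₀⁻¹
  have hr₀' : 1 < r₀⁻¹ := (one_lt_inv₀ hr₀).2 hr₀1
  have ht1 : 1 < ‖t‖ := hr₀'.trans ht
  have ht0 : t ≠ 0 := norm_pos_iff.1 (one_pos.trans ht1)
  refine ⟨t, ht1, fun g hg => ?_⟩
  have heq : (fun _ : Fin 3 => t) = t • (fun _ : Fin 3 => (1 : (basePlaceOf L i).adicCompletion L⁺)) := by
    funext j
    simp only [Pi.smul_apply, smul_eq_mul, mul_one]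
  rw [heq, mem_U1_smul_iff ht0] at hg
  have hle : 1 / ‖t‖ ≤ r₀ := by
    rw [one_div_le (one_pos.trans ht1) hr₀, one_div]
    exact ht.le
  exact h (1 / ‖t‖) (by positivity) hle g hg

open Classical in
/-- a centre scale `t_v` at every place: the chosen one at the split places, `0` at the others -/
def centre (χ : Model L →* Circle) {T' : Finset (Place L⁺)}
    (hχT' : RestrictedProduct.boxSubgroup (genLevel L) T' ≤ χ.ker)
    (hlocχ : ∀ i ∈ T', Continuous fun g : locTorus L⁺ L i => χ (RestrictedProduct.mulSingle (genLevel L) i g))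
    (i : Place L⁺) : (basePlaceOf L i).adicCompletion L⁺ :=
  if hs : IsSplitPlace L i then Classical.choose (exists_centre χ hχT' hlocχ i hs) else 0

/-- (Ported verbatim from the HodgeCMPerL package; no docstring in the source.) -/
theorem centre_spec (χ : Model L →* Circle) {T' : Finset (Place L⁺)}
    (hχT' : RestrictedProduct.boxSubgroup (genLevel L) T' ≤ χ.ker)
    (hlocχ : ∀ i ∈ T', Continuous fun g : locTorus L⁺ L i => χ (RestrictedProduct.mulSingle (genLevel L) i g))
    (i : Place L⁺) (hs : IsSplitPlace L i) :
    1 < ‖centre χ hχT' hlocχ i‖ ∧ ∀ g : locTorus L⁺ L i,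
      ((baseTriv L i hs g : ((basePlaceOf L i).adicCompletion L⁺)ˣ) : (basePlaceOf L i).adicCompletion L⁺) ∈
          U1 (fun _ : Fin 3 => centre χ hχT' hlocχ i) 1 →
        χ (RestrictedProduct.mulSingle (genLevel L) i g) = 1 := by
  have hc : centre χ hχT' hlocχ i = Classical.choose (exists_centre χ hχT' hlocχ i hs) := by
    simp only [centre, dif_pos hs]
  rw [hc]
  exact Classical.choose_spec (exists_centre χ hχT' hlocχ i hs)

/-- the shift attached to `(S, χ)`: `(t_v, t_v, t_v)` at the split `v ∈ S`, `0` elsewhere -/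
def shiftFor (S : Finset (Place L⁺)) (χ : Model L →* Circle) {T' : Finset (Place L⁺)}
    (hχT' : RestrictedProduct.boxSubgroup (genLevel L) T' ≤ χ.ker)
    (hlocχ : ∀ i ∈ T', Continuous fun g : locTorus L⁺ L i => χ (RestrictedProduct.mulSingle (genLevel L) i g)) :
    Space L :=
  shiftVec S (centre χ hχT' hlocχ)

/-! ## §6  The S3 input for `S` containing split places, and all torus-side END binders -/

/-- **The genuine global split Schrödinger model, twisted by `ν_χ` and SHIFTED by `e(S, χ)`, is an S3 input for
EVERY finite set `S` of places and EVERY character `χ` with a level**: at a split `v ∈ S` the ball is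
`D_v = closedBall (t_v,t_v,t_v) 1 = (t_v,t_v,t_v) + 𝒪_v³` (`‖t_v‖ > 1`, so `r = 1 < ‖x₀‖` and `0 ∉ D_v`), `a_v = 1`,
`ν_v = 1`, the intertwiners are the shifted coordinate intertwiners `V^e_v`, and `χ(ι_v g) = 1` on `U1 x₀ 1` by the
choice of `t_v`; at a non-split `v ∈ S` the twist gives the isotypy `hiso`. -/
def thetaInputShift (S : Finset (Place L⁺)) (χ : Model L →* Circle) {T' : Finset (Place L⁺)}
    (hχT' : RestrictedProduct.boxSubgroup (genLevel L) T' ≤ χ.ker)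
    (hlocχ : ∀ i ∈ T', Continuous fun g : locTorus L⁺ L i => χ (RestrictedProduct.mulSingle (genLevel L) i g)) :
    GenuineThetaInput L S (Lp ℂ 2 (μ L)) (rep L (twistChar L χ)) (phiE (shiftFor S χ hχT' hlocχ)) χ where
  ν := fun _ => 1
  hν := fun _ _ _ _ _ => rfl
  VU := fun i _ hs => Ve (shiftFor S χ hχT' hlocχ) ⟨i, hs⟩
  hVUψ := fun i hi hs => by
    have h0 : shiftFor S χ hχT' hlocχ ⟨i, hs⟩ = 0 := shiftVec_apply_of_not_mem _ hi
    have h := Ve_ballIndicator (shiftFor S χ hχT' hlocχ) ⟨i, hs⟩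
    rw [h0] at h
    exact h
  hVU := fun i _ hs g => by
    rw [rep_twist_mulSingle_of_split χ hs]
    exact rep_mulSingle_Ve _ ⟨i, hs⟩ g _
  x₀ := fun i _ => centre χ hχT' hlocχ i
  r := fun _ => 1
  a := fun _ => 1
  hr := fun i _ hs => by
    show (1 : ℝ) < ‖fun _ : Fin 3 => centre χ hχT' hlocχ i‖
    rw [pi_norm_const]
    exact (centre_spec χ hχT' hlocχ i hs).1
  hr0 := fun _ _ _ => one_pos
  hνS := fun _ _ _ _ _ => rfl
  hχS := fun i _ hs g hg => (centre_spec χ hχT' hlocχ i hs).2 g hg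
  VS := fun i _ hs => Ve (shiftFor S χ hχT' hlocχ) ⟨i, hs⟩
  hVSψ := fun i hi hs => by
    have h1 : shiftFor S χ hχT' hlocχ ⟨i, hs⟩ = fun _ => centre χ hχT' hlocχ i := shiftVec_apply_of_mem _ hi
    have h := Ve_ballIndicator (shiftFor S χ hχT' hlocχ) ⟨i, hs⟩
    rw [h1] at h
    show Ve (shiftFor S χ hχT' hlocχ) ⟨i, hs⟩ ((1 : ℂ) •
      ballIndicator (Adic.muV L⁺ (basePlaceOf L i)) (fun _ : Fin 3 => centre χ hχT' hlocχ i) 1) = _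
    rw [one_smul]
    exact h
  hVS := fun i _ hs g => by
    rw [rep_twist_mulSingle_of_split χ hs]
    exact rep_mulSingle_Ve _ ⟨i, hs⟩ g _
  hiso := fun i hi hns g => by
    rw [rep_eq_smul_rep_one, rep_mulSingle_of_not_isSplitPlace hns g, twistChar_mulSingle_of_not χ hns,
      Circle.coe_inv_eq_conj]

/-- NON-VACUITY of the S3 input for every finite `S` and every `χ` with a level -/
theorem nonempty_thetaInput_shift (S : Finset (Place L⁺)) (χ : Model L →* Circle) {T' : Finset (Place L⁺)}
    (hχT' : RestrictedProduct.boxSubgroup (genLevel L) T' ≤ χ.ker)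
    (hlocχ : ∀ i ∈ T', Continuous fun g : locTorus L⁺ L i => χ (RestrictedProduct.mulSingle (genLevel L) i g)) :
    Nonempty (GenuineThetaInput L S (Lp ℂ 2 (μ L)) (rep L (twistChar L χ)) (phiE (shiftFor S χ hχT' hlocχ)) χ) :=
  ⟨thetaInputShift S χ hχT' hlocχ⟩

/-- `hK` for the shifted twisted model: on any level `T ⊇ S ∪ T'` -/
theorem torusSideShift_hK (S : Finset (Place L⁺)) (χ : Model L →* Circle) {T' T : Finset (Place L⁺)}
    (hχT' : RestrictedProduct.boxSubgroup (genLevel L) T' ≤ χ.ker)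
    (hlocχ : ∀ i ∈ T', Continuous fun g : locTorus L⁺ L i => χ (RestrictedProduct.mulSingle (genLevel L) i g))
    (hT'T : T' ⊆ T) (hST : S ⊆ T) :
    ∀ k ∈ RestrictedProduct.boxSubgroup (genLevel L) T,
      rep L (twistChar L χ) k (phiE (shiftFor S χ hχT' hlocχ)) = phiE (shiftFor S χ hχT' hlocχ) := by
  refine rep_phiE_eq_self_of_mem_boxSubgroup_of_char _ (twistChar L χ) T
    (fun j hj => shiftVec_apply_of_not_mem _ fun h => hj (hST h)) fun k hk => ?_
  rw [twistChar_apply, inv_eq_one]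
  exact hχT' (boxSubgroup_antitone (genLevel L) hT'T (prNonsplit_mem_boxSubgroup hk))

/-- `hM` for the shifted twisted model -/
theorem torusSideShift_hM (S : Finset (Place L⁺)) (χ : Model L →* Circle) {T' : Finset (Place L⁺)}
    (hχT' : RestrictedProduct.boxSubgroup (genLevel L) T' ≤ χ.ker)
    (hlocχ : ∀ i ∈ T', Continuous fun g : locTorus L⁺ L i => χ (RestrictedProduct.mulSingle (genLevel L) i g))
    (T : Finset (Place L⁺)) :
    ∀ S' : Finset (Place L⁺), T ⊆ S' → ∀ y : (i : ↥S') → locTorus L⁺ L i,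
      inner ℂ (phiE (shiftFor S χ hχT' hlocχ))
          (rep L (twistChar L χ) (extendOne (genLevel L) S' y) (phiE (shiftFor S χ hχT' hlocχ))) =
        ∏ i : ↥S', localCoeff (genLevel L) (rep L (twistChar L χ)) (phiE (shiftFor S χ hχT' hlocχ)) i (y i) := by
  intro S' _ y
  obtain ⟨Se, hSe⟩ := exists_finset_shiftVec_eq_zero S (centre χ hχT' hlocχ)
  exact inner_phiE_rep_extendOne _ Se hSe (twistChar L χ) S' y

/-- **SUMMARY (torus side of the S3 END theorem for an ARBITRARY finite set of places `S`).**  For every CM field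
`L`, every finite `S`, every character `χ` of `U(1)(𝔸_{L⁺})` with a level `T' ⊆ S` (`K_{T'} ≤ ker χ`, local
components continuous on `T'` — exactly the END's `hχT'`, `hlocχ`, `hT'S`), the shifted twisted genuine split
Schrödinger model supplies `Sp, ω, φ` with: an S3 input `X`, `‖φ‖ = 1`, `hloc`, `hK` (for `T := S`) and `hM` — every
`(ω, φ)`-side hypothesis of `exists_compactDomain_thetaLift_ne_zero_genuine_of_input`, split ramification of `χ`
included. -/
theorem torusSideShift (S : Finset (Place L⁺)) (χ : Model L →* Circle) {T' : Finset (Place L⁺)}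
    (hχT' : RestrictedProduct.boxSubgroup (genLevel L) T' ≤ χ.ker)
    (hlocχ : ∀ i ∈ T', Continuous fun g : locTorus L⁺ L i => χ (RestrictedProduct.mulSingle (genLevel L) i g))
    (hT'S : T' ⊆ S) :
    Nonempty (GenuineThetaInput L S (Lp ℂ 2 (μ L)) (rep L (twistChar L χ)) (phiE (shiftFor S χ hχT' hlocχ)) χ) ∧
    ‖phiE (shiftFor S χ hχT' hlocχ)‖ = 1 ∧
    (∀ (i : Place L⁺) (v : Lp ℂ 2 (μ L)),
      Continuous fun g : locTorus L⁺ L i => rep L (twistChar L χ) (RestrictedProduct.mulSingle (genLevel L) i g) v) ∧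
    (∀ k ∈ RestrictedProduct.boxSubgroup (genLevel L) S,
      rep L (twistChar L χ) k (phiE (shiftFor S χ hχT' hlocχ)) = phiE (shiftFor S χ hχT' hlocχ)) ∧
    (∀ S' : Finset (Place L⁺), S ⊆ S' → ∀ y : (i : ↥S') → locTorus L⁺ L i,
      inner ℂ (phiE (shiftFor S χ hχT' hlocχ))
          (rep L (twistChar L χ) (extendOne (genLevel L) S' y) (phiE (shiftFor S χ hχT' hlocχ))) =
        ∏ i : ↥S', localCoeff (genLevel L) (rep L (twistChar L χ)) (phiE (shiftFor S χ hχT' hlocχ)) i (y i)) :=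
  ⟨nonempty_thetaInput_shift S χ hχT' hlocχ, norm_phiE _, torusSide_hloc_of_level χ hχT' hlocχ,
    torusSideShift_hK S χ hχT' hlocχ hT'S subset_rfl, torusSideShift_hM S χ hχT' hlocχ S⟩

end Main

end Coeff

end SchrodingerModel

end HodgeCM.PerL34.PureTensor

end
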